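import Summits.ValiantsHypothesis.ValiantsHypothesis.Theorems.KPlusLogSqLawTropicalBChangedSetLaw
import Literature.Combinatorics.Expanders.Concentrator

/-!
# Route «KPlusLogSqLaw», crux `TropicalB` (stmt-ValiantsHypothesis-19771) — asymptotically ONE revisit per permutation and
# slope class: `T(m,K) + 1 ≤ m! + (K−1)·m!·(3m+4)/(3(m − 3⌊√m⌋ − 2))` for `m ≥ 16`

HONEST FRAMING.  Helper toward the crux `Summit.ValiantsHypothesis.ValiantsHypothesis.Theses.KPlusLogSqLaw.TropicalB` (ledger item
`stmt-ValiantsHypothesis-19771`, registered stubs `stub_tropThin` / `stub_tropFat` of `Cruxes/TropicalB/Lines/birth.lean`; cell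
`pub-symmetroid`, seat val-sym-trop-p4 g5, 2026-08-27; `--supports … --as helper`).  Sequel of `…TropicalBChangedSetLaw` (p481625, imported)
and companion of `…TropicalBFiveHalves` (p482166): the changed-set law
`(R+1)(n+1) ≤ (R+1)|Π| + (K−1)·(Σ_{r=1}^{R}(R+1−r)·N_r + m|Π|)`, `N_r = C(m,r)·m!/(m−r)!`, evaluated at the (near-optimal) cut
`R + 1 = m − 3(⌊√m⌋ + 1) + 1`, where the signature sum is geometrically dominated by its last term and that term is `≤ m!`.  A bound
in the SUPER-FAT corner `K ≫ m`, OFF the window `⌊log₂ m⌋ + 1 < K < m` of the crux; nothing here bears on `TropicalB` in the window, on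
`WeakLifting` / `Lifting`, on the cell's real census / DoorA26 / DoorA34, on `MatrixDescartes` (stmt-ValiantsHypothesis-18050) or on
VP ≠ VNP.  `T(m,K)` = the least `B` with `TropRootLawAt m K B`.

CONTENT (write `s = ⌊√m⌋`, `J + 1 = 3(s+1)`, `R + 1 = m − J`; all for `m ≥ 16`, so that `R + 1 ≥ 1`).
* arithmetic: the tree's `Literature.Combinatorics.Expanders.pow_self_le_three_pow_mul_factorial` (`n^n ≤ 3^n·n!`),
  `pow_le_factorial_sq` (`m^(3(s+1)) ≤ (3(s+1))!²`), hence `choose_le_factorial_cut` (`C(m, J+1) ≤ (J+1)!`) and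
  `lastTerm_le_factorial` (`N_R = C(m,R)·m!/(m−R)! ≤ m!` at the cut).
* `four_mul_term_le_succ` (ratio ≥ 4 between consecutive weighted terms below the cut, since `(m−r+1)² ≥ 9(s+1)² > 8r`) and
  `three_mul_sum_le_four_mul_last` (geometric domination: `3·Σ_{r=1}^{R}(R+1−r)N_r ≤ 4·N_R`).
* `tropRootLawAt_oneRevisit` (THE ROW): for `m ≥ 16`,
  `3(m−J)·(T(m,K)+1) ≤ 3(m−J)·m! + (K−1)·(3m+4)·m!`, i.e. `T(m,K)+1 ≤ m! + (K−1)·m!·(3m+4)/(3(m−3s−2))`: the number of chain terms per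
  permutation and slope class is at most `(3m+4)/(3(m − 3⌊√m⌋ − 2)) = 1 + O(1/√m)` (`1.49` at `m = 100`, `1.031` at `m = 10⁴`), against
  `m` (thin law p406287), `m/2` (half-thin p476649) and `5/2` (uniform row p482166, which remains the better row for small `m`).
So the changed-set method's limit is exactly «one revisit per permutation per class»; whether the true slope of the `m`-row is of order
`m!` at all (lower bounds known to the cell are linear in `m`: direct sums of the `m = 2, 3` families) is OPEN.  [this cell]
-/

-- `Summit.ValiantsHypothesis.ValiantsHypothesis.…` repeats a component by the D-0017 layout
-- (single-conjunct summit), which the `dupNamespace` linter flags; the name is mandated.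
set_option linter.dupNamespace false
set_option autoImplicit false

namespace Summit.ValiantsHypothesis.ValiantsHypothesis.Theorems.KPlusLogSqLaw

open Summit.ValiantsHypothesis.ValiantsHypothesis.Theorems.MatrixDescartes.Negative
open Summit.ValiantsHypothesis.ValiantsHypothesis.Theorems.LacunarySymmetroidMatrixDescartes.TropicalCensus
open Finset

namespace RefreshExclusivity

/-! ## 1. Arithmetic at the cut `J + 1 = 3(⌊√m⌋+1)` -/

/-- at the cut `n = 3(⌊√m⌋+1)`: `m^n ≤ n!²`. -/
theorem pow_le_factorial_sq (m : ℕ) :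
    m ^ (3 * (Nat.sqrt m + 1)) ≤ (3 * (Nat.sqrt m + 1)).factorial ^ 2 := by
  set s := Nat.sqrt m with hs
  set n := 3 * (s + 1) with hn
  have h1 : (s + 1) ^ n ≤ n.factorial := by
    have h := Literature.Combinatorics.Expanders.pow_self_le_three_pow_mul_factorial n
    have e : n ^ n = 3 ^ n * (s + 1) ^ n := by rw [hn, mul_pow]
    rw [e] at h
    exact Nat.le_of_mul_le_mul_left h (by positivity)
  have h2 : m ≤ (s + 1) ^ 2 := (Nat.lt_succ_sqrt' m).le
  calc m ^ n ≤ ((s + 1) ^ 2) ^ n := Nat.pow_le_pow_left h2 n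
    _ = ((s + 1) ^ n) ^ 2 := by rw [← pow_mul, ← pow_mul, mul_comm]
    _ ≤ n.factorial ^ 2 := Nat.pow_le_pow_left h1 2

/-- at the cut: `C(m, J+1) ≤ (J+1)!`, `J + 1 = 3(⌊√m⌋+1)`. -/
theorem choose_le_factorial_cut (m : ℕ) :
    m.choose (3 * (Nat.sqrt m + 1)) ≤ (3 * (Nat.sqrt m + 1)).factorial := by
  set n := 3 * (Nat.sqrt m + 1) with hn
  have h1 : m.choose n * n.factorial ≤ n.factorial * n.factorial := by
    calc m.choose n * n.factorial = m.descFactorial n := by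
          rw [Nat.descFactorial_eq_factorial_mul_choose, mul_comm]
      _ ≤ m ^ n := Nat.descFactorial_le_pow m n
      _ ≤ n.factorial ^ 2 := pow_le_factorial_sq m
      _ = n.factorial * n.factorial := sq _
  exact Nat.le_of_mul_le_mul_right h1 (Nat.factorial_pos n)

/-- the LAST TERM at the cut is at most `m!`: `C(m,R)·m!/(m−R)! ≤ m!` for `R = m − 3(⌊√m⌋+1)` (`m ≥ 16`). -/
theorem lastTerm_le_factorial {m R : ℕ} (hR : R + 3 * (Nat.sqrt m + 1) = m) :
    m.choose R * m.descFactorial R ≤ m.factorial := by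
  set n := 3 * (Nat.sqrt m + 1) with hn
  have hRm : R ≤ m := by omega
  have hmR : m - R = n := by omega
  have h1 : m.choose R = m.choose n := by
    rw [← hmR]; exact (Nat.choose_symm hRm).symm
  have h2 : m.choose R * m.descFactorial R * n.factorial ≤ m.factorial * n.factorial := by
    calc m.choose R * m.descFactorial R * n.factorial = m.choose n * ((m - R).factorial * m.descFactorial R) := by
          rw [h1, hmR]; ring
      _ = m.choose n * m.factorial := by rw [Nat.factorial_mul_descFactorial hRm]
      _ ≤ n.factorial * m.factorial := Nat.mul_le_mul_right _ (choose_le_factorial_cut m)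
      _ = m.factorial * n.factorial := mul_comm _ _
  exact Nat.le_of_mul_le_mul_right h2 (Nat.factorial_pos n)

/-! ## 2. Geometric domination of the signature sum below the cut -/

/-- RATIO STEP: below the cut consecutive weighted terms grow by a factor `≥ 4`:
`4·(R+2−r)·N_{r−1} ≤ (R+1−r)·N_r` for `1 ≤ r ≤ R`, because `(m−r+1)² ≥ 9(⌊√m⌋+1)² > 8r`. -/
theorem four_mul_term_le_succ {m R r : ℕ} (hR : R + 3 * (Nat.sqrt m + 1) = m) (hr1 : 1 ≤ r) (hrR : r ≤ R) :
    4 * ((R + 1 - (r - 1)) * (m.choose (r - 1) * m.descFactorial (r - 1))) ≤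
      (R + 1 - r) * (m.choose r * m.descFactorial r) := by
  obtain ⟨k, rfl⟩ : ∃ k, r = k + 1 := ⟨r - 1, by omega⟩
  simp only [Nat.add_sub_cancel]
  have hsq : m < (Nat.sqrt m + 1) ^ 2 := Nat.lt_succ_sqrt' m
  have hmk : 3 * (Nat.sqrt m + 1) ≤ m - k := by omega
  have hkey : 4 * (k + 1) * (R + 1 - k) ≤ (R - k) * ((m - k) * (m - k)) := by
    have h8 : 8 * (k + 1) ≤ (m - k) * (m - k) := by
      have hA : 3 * (Nat.sqrt m + 1) * (3 * (Nat.sqrt m + 1)) ≤ (m - k) * (m - k) := Nat.mul_le_mul hmk hmk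
      have hB : k + 1 ≤ m := by omega
      have hC : (Nat.sqrt m + 1) ^ 2 = (Nat.sqrt m + 1) * (Nat.sqrt m + 1) := sq _
      nlinarith [hA, hB, hsq, hC]
    have h9 : R + 1 - k ≤ 2 * (R - k) := by omega
    calc 4 * (k + 1) * (R + 1 - k) ≤ 4 * (k + 1) * (2 * (R - k)) := Nat.mul_le_mul_left _ h9
      _ = (R - k) * (8 * (k + 1)) := by ring
      _ ≤ (R - k) * ((m - k) * (m - k)) := Nat.mul_le_mul_left _ h8
  -- multiply the claim by `k + 1 > 0` and use `C(m,k+1)(k+1) = C(m,k)(m−k)`, `descFact(m,k+1) = (m−k)·descFact(m,k)`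
  have hmul : (k + 1) * (4 * ((R + 1 - k) * (m.choose k * m.descFactorial k))) ≤
      (k + 1) * ((R + 1 - (k + 1)) * (m.choose (k + 1) * m.descFactorial (k + 1))) := by
    have e1 : (k + 1) * ((R + 1 - (k + 1)) * (m.choose (k + 1) * m.descFactorial (k + 1))) =
        (R - k) * ((m.choose (k + 1) * (k + 1)) * m.descFactorial (k + 1)) := by
      rw [show R + 1 - (k + 1) = R - k by omega]; ring
    rw [e1, Nat.choose_succ_right_eq, Nat.descFactorial_succ]
    calc (k + 1) * (4 * ((R + 1 - k) * (m.choose k * m.descFactorial k)))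
        = (4 * (k + 1) * (R + 1 - k)) * (m.choose k * m.descFactorial k) := by ring
      _ ≤ ((R - k) * ((m - k) * (m - k))) * (m.choose k * m.descFactorial k) := Nat.mul_le_mul_right _ hkey
      _ = (R - k) * (m.choose k * (m - k) * ((m - k) * m.descFactorial k)) := by ring
  exact Nat.le_of_mul_le_mul_left hmul (Nat.succ_pos k)

/-- GEOMETRIC DOMINATION: `3·Σ_{r=1}^{t}(R+1−r)·N_r ≤ 4·(R+1−t)·N_t` for `1 ≤ t ≤ R` (so at `t = R`: `≤ 4·N_R`). -/
theorem three_mul_sum_le_four_mul_last {m R : ℕ} (hR : R + 3 * (Nat.sqrt m + 1) = m) {t : ℕ} (ht1 : 1 ≤ t) (htR : t ≤ R) :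
    3 * (∑ r ∈ Icc 1 t, (R + 1 - r) * (m.choose r * m.descFactorial r)) ≤
      4 * ((R + 1 - t) * (m.choose t * m.descFactorial t)) := by
  induction t, ht1 using Nat.le_induction with
  | base =>
    rw [Finset.Icc_self, Finset.sum_singleton]
    exact Nat.mul_le_mul_right _ (by norm_num)
  | succ t ht ih =>
    have ih' := ih (by omega)
    have hstep := four_mul_term_le_succ hR (by omega : 1 ≤ t + 1) htR
    simp only [Nat.add_sub_cancel] at hstep
    rw [Finset.sum_Icc_succ_top (by omega : 1 ≤ t + 1)]
    linarith

/-- the signature sum at the cut is at most `(4/3)·m!`: `3·Σ_{r=1}^{R}(R+1−r)·N_r ≤ 4·m!`. -/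
theorem three_mul_sum_le_four_mul_factorial {m R : ℕ} (hR : R + 3 * (Nat.sqrt m + 1) = m) :
    3 * (∑ r ∈ Icc 1 R, (R + 1 - r) * (m.choose r * m.descFactorial r)) ≤ 4 * m.factorial := by
  rcases Nat.eq_zero_or_pos R with hR0 | hRpos
  · subst hR0
    simp
  calc 3 * (∑ r ∈ Icc 1 R, (R + 1 - r) * (m.choose r * m.descFactorial r))
      ≤ 4 * ((R + 1 - R) * (m.choose R * m.descFactorial R)) := three_mul_sum_le_four_mul_last hR hRpos le_rfl
    _ = 4 * (m.choose R * m.descFactorial R) := by rw [Nat.add_sub_cancel_left, one_mul]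
    _ ≤ 4 * m.factorial := Nat.mul_le_mul_left _ (lastTerm_le_factorial hR)

/-! ## 3. The row -/

/-- **ONE REVISIT PER PERMUTATION AND CLASS, asymptotically.**  For `m ≥ 16`, with `s = ⌊√m⌋`:
`3(m − 3s − 2)·(T(m,K)+1) ≤ 3(m − 3s − 2)·m! + (K−1)·(3m+4)·m!`, i.e. `T(m,K) + 1 ≤ m! + (K−1)·m!·(3m+4)/(3(m−3s−2))` — at most
`1 + O(1/√m)` chain terms per permutation and slope class.  A super-fat-corner bound, off the window of the crux.
[this cell, val-sym-trop-p4 g5] -/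
theorem tropRootLawAt_oneRevisit {m : ℕ} (hm : 16 ≤ m) (K : ℕ) :
    TropRootLawAt m K ((3 * (m - 3 * Nat.sqrt m - 2) * m.factorial + (K - 1) * ((3 * m + 4) * m.factorial)) /
      (3 * (m - 3 * Nat.sqrt m - 2)) - 1) := by
  set s := Nat.sqrt m with hs
  have hs4 : 4 ≤ s := by
    rw [hs, Nat.le_sqrt]
    omega
  have hss : s * s ≤ m := Nat.sqrt_le m
  have h4s : 4 * s ≤ s * s := Nat.mul_le_mul_right s hs4
  have hcut : 3 * (s + 1) + 1 ≤ m := le_trans (le_trans (by omega : 3 * (s + 1) + 1 ≤ 4 * s) h4s) hss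
  obtain ⟨R, hR⟩ : ∃ R, R + 3 * (Nat.sqrt m + 1) = m := ⟨m - 3 * (s + 1), by omega⟩
  have hR1 : R + 1 = m - 3 * Nat.sqrt m - 2 := by omega
  rw [← hR1]
  intro d v ε n θ p _hε hθ hdom halt
  classical
  have hlaw := succ_mul_succ_le_changedSet d v ε θ p hθ hdom halt R
  have hPi : (univ.image fun k => (p k).1).card ≤ m.factorial :=
    (Finset.card_le_univ _).trans (le_of_eq (by rw [Fintype.card_perm, Fintype.card_fin]))
  have hsum := three_mul_sum_le_four_mul_factorial hR
  have h1 : (R + 1) * (n + 1) ≤ (R + 1) * m.factorial + (K - 1) *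
      ((∑ r ∈ Icc 1 R, (R + 1 - r) * (m.choose r * m.descFactorial r)) + m.factorial * m) := by
    refine hlaw.trans (Nat.add_le_add (Nat.mul_le_mul_left _ hPi) (Nat.mul_le_mul_left _ ?_))
    exact Nat.add_le_add_left (Nat.mul_le_mul_right _ hPi) _
  have h2 : (n + 1) * (3 * (R + 1)) ≤ 3 * (R + 1) * m.factorial + (K - 1) * ((3 * m + 4) * m.factorial) := by
    calc (n + 1) * (3 * (R + 1)) = 3 * ((R + 1) * (n + 1)) := by ring
      _ ≤ 3 * ((R + 1) * m.factorial + (K - 1) *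
          ((∑ r ∈ Icc 1 R, (R + 1 - r) * (m.choose r * m.descFactorial r)) + m.factorial * m)) :=
          Nat.mul_le_mul_left _ h1
      _ = 3 * (R + 1) * m.factorial + (K - 1) *
          (3 * (∑ r ∈ Icc 1 R, (R + 1 - r) * (m.choose r * m.descFactorial r)) + 3 * m * m.factorial) := by ring
      _ ≤ 3 * (R + 1) * m.factorial + (K - 1) * (4 * m.factorial + 3 * m * m.factorial) :=
          Nat.add_le_add_left (Nat.mul_le_mul_left _ (Nat.add_le_add_right hsum _)) _
      _ = 3 * (R + 1) * m.factorial + (K - 1) * ((3 * m + 4) * m.factorial) := by ring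
  have h3 : n + 1 ≤ (3 * (R + 1) * m.factorial + (K - 1) * ((3 * m + 4) * m.factorial)) / (3 * (R + 1)) :=
    (Nat.le_div_iff_mul_le (by positivity)).mpr h2
  omega

/-- arithmetic remark: the per-class coefficient `(3m+4)/(3(m−3⌊√m⌋−2))` is below the uniform `5/2` of p482166 exactly when
`m ≥ 34` (`2(3m+4) ≤ 15(m − 3s − 2)` iff `9m ≥ 45s + 38`); e.g. at `m = 100` it is `304/204 < 3/2`. -/
theorem oneRevisit_coeff_lt_fiveHalves {m : ℕ} (hm : 34 ≤ m) :
    2 * (3 * m + 4) < 5 * (3 * (m - 3 * Nat.sqrt m - 2)) := by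
  set s := Nat.sqrt m with hs
  have hss : s * s ≤ m := Nat.sqrt_le m
  have hs5 : 5 ≤ s := by
    rw [hs, Nat.le_sqrt]
    omega
  rcases hs5.eq_or_lt with h5 | h6
  · omega
  · have h6' : 6 * s ≤ m := le_trans (Nat.mul_le_mul_right s h6) hss
    omega

end RefreshExclusivity

end Summit.ValiantsHypothesis.ValiantsHypothesis.Theorems.KPlusLogSqLaw
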